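import Literature.Probability.RandomPlanarGeometry.SLEOnePointSwallowingProofs
import Literature.Probability.RandomPlanarGeometry.SLEAdaptedProofs
import Literature.Probability.Process.ContinuousHitting
import Literature.Probability.Process.ItoIntegralStopping
import Literature.Probability.Process.ItoIntegralLocality
import Literature.Probability.Process.ProgressiveDensity
import HarnessLib

/-!
# The stopped real SLE_κ flow is an Itô process (`dX = (2/X) dt - √κ dB` before swallowing)

Topic `Probability/RandomPlanarGeometry`; theorems only. This file supplies the common first step
of the three Itô computations behind Cardy's formula for SLE₆ in the tree
(`Literature.Probability.RandomPlanarGeometry.sle_martingale_onePointPow`,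
`sle_martingale_onePointSq` of `SLEOnePointMartingale`, and `sle_martingale_twoPointObservable` of
`SLETwoPointMartingale`; cf. `CritPerc.sle_six_measureReal_hitsBefore_of_itoSteps`): the real
Loewner flow of chordal SLE_κ seen from the driving point, `Xₜ = re gₜ(x) - √κ Bₜ` (frozen at `0`
from the swallowing time `T_x` on: `Literature.Probability.RandomPlanarGeometry.sleRealFlowStop`),
stopped at a stopping time `ρ` of the raw Brownian filtration before which it does not vanish, is
an **Itô process** in the sense of `Literature.Analysis.FunctionSpaces.IsItoProcess`, driven by the
canonical Brownian motion, with drift `𝟙_{s ≤ ρ} 2/X_s` and diffusion coefficient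
`𝟙_{s ≤ ρ}(-√κ)` (`isItoProcess_stoppedProcess_sleRealFlowStop`). This is Lawler's SDE
`dX = (a/X) dt + dB` (Lawler (2005), §1.10; §6.2 eq. (6.3), `a = 2/κ` in his time
normalisation `ĝ`), i.e. `dX = (2/X) dt - √κ dB` in the normalisation of `LoewnerChain`, localised
before `T_x`; it is exactly the input that Itô's formula for Itô processes
(`Literature.Analysis.FunctionSpaces.ito_formula_itoProcess_ae`, proved in `ItoFormulaProofs`)
consumes.

Contents:
* pathwise (any continuous driving function `W`, any real `x ≠ W₀`): the integrated Loewner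
  equation for real points `Xₜ = x - Wₜ + ∫₀ᵗ 2/X_s ds`, `t < T_x`
  (`Loewner.realFlow_eq_sub_add_integral`, fundamental theorem of calculus along
  `IsSolution.hasDerivAt_re`), its frozen-flow form, the reflection
  `realFlowStop (-W) (-x) = -realFlowStop W x` and continuity of the frozen flow also for points
  to the left of the driving point;
* for SLE_κ: continuity, adaptedness and progressivity of `sleRealFlowStop κ x` (`x ≠ 0`), the
  pathwise identity `X^ρ_t = x + ∫₀ᵗ 𝟙_{s≤ρ} 2/X^ρ_s ds - √κ B_{t∧ρ}`
  (`stoppedProcess_sleRealFlowStop_eq`), and the Itô-process statement: the stochastic term is the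
  square-integrable Itô integral of the truncated constant `𝟙_{[0,ρ]}(-√κ)`
  (`Literature.Probability.Process.exists_isItoIntegral_of_sq_integrable`), indistinguishable from
  `-√κ B^ρ` by `IsItoIntegral.ae_eq_stoppedProcess` (Revuz–Yor IV Prop. (2.5)) and
  `isItoIntegral_const_brownian`.

## References

* G. F. Lawler, *Conformally Invariant Processes in the Plane*, AMS (2005), §1.10 (Bessel SDE
  `X_t = x + B_t + a∫₀ᵗ ds/X_s`, `t ≤ T_x`; proof of Prop. 1.21), §6.2 eq. (6.3), Prop. 6.8.
* D. Revuz, M. Yor, *Continuous Martingales and Brownian Motion* (3rd ed., 1999), Ch. IV,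
  Prop. (2.5), Prop. (2.10)(ii) (`K𝟙_{[0,T]}·M = (K·M)^T`); Ch. IX, Def. (1.2).
-/

noncomputable section

open MeasureTheory Filter Topology Set Complex
open scoped NNReal ENNReal

namespace Literature.Probability.RandomPlanarGeometry

namespace Loewner

variable {W : ℝ≥0 → ℝ}

/-! ### The real flow in integrated form (pathwise) -/

/-- **The real Loewner flow in integrated form** (pathwise, any real point `x ≠ W₀`): for
`t < T_x`, `Xₜ = x - Wₜ + ∫₀ᵗ 2/X_s ds`, where `X_s = re g_s(x) - W_s = realFlow W x s`. This is
the fundamental theorem of calculus for `s ↦ re g_s(x)`, whose derivative on `(0, t)` is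
`2/(re g_s(x) - W_s)` (`IsSolution.hasDerivAt_re`), continuous on `[0, t]`.
Lawler (2005), §1.10 ("if `t ≤ T_x` then `X_t = x + B_t + a∫₀ᵗ ds/X_s`") and §6.2, eq. (6.3).
[cite: Lawler2005, Prop. 1.21] -/
theorem realFlow_eq_sub_add_integral (hW : Continuous W) {x : ℝ} (hx : x ≠ W 0) {t : ℝ≥0}
    (ht : (t : WithTop ℝ≥0) < swallowingTime W x) :
    realFlow W x t = x - W t + ∫ s in (0 : ℝ)..t, 2 / realFlow W x s.toNNReal := by
  have hx' : (x : ℂ) ≠ W 0 := fun h ↦ hx (by exact_mod_cast h)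
  obtain ⟨g, hg⟩ := exists_isSolution_swallowingTime_holds hW hx'
  have ht' : ((t : ℝ).toNNReal : WithTop ℝ≥0) < swallowingTime W x := by simpa using ht
  have hsub := Icc_subset_timeDomain ht'
  -- the real part of the solution and its derivative
  set G : ℝ → ℝ := fun s ↦ (g s).re with hG
  set G' : ℝ → ℝ := fun s ↦ 2 / ((g s).re - W s.toNNReal) with hG'
  have hcont : ContinuousOn G (Icc 0 t) :=
    continuous_re.comp_continuousOn (hg.continuousOn.mono hsub)
  have hderiv : ∀ s ∈ Ioo (0 : ℝ) t, HasDerivAt G (G' s) s := fun s hs ↦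
    hg.hasDerivAt_re hs.1 (hsub ⟨hs.1.le, hs.2.le⟩).2
  have hne : ∀ s ∈ Icc (0 : ℝ) t, (g s).re - W s.toNNReal ≠ 0 := by
    intro s hs h0
    have him : (g s).im = 0 := IsSolution.im_eq_zero_holds hg (ofReal_im x) s hs.1 (hsub hs).2
    have hgs : g s = W s.toNNReal := Complex.ext (by simpa [sub_eq_zero] using h0) (by simp [him])
    exact hg.2.2 s hs.1 (hsub hs).2 hgs
  have hcont' : ContinuousOn G' (Icc 0 t) := by
    refine continuousOn_const.div ?_ hne
    exact (continuous_re.comp_continuousOn (hg.continuousOn.mono hsub)).sub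
      ((hW.comp continuous_real_toNNReal).continuousOn)
  have hFTC := intervalIntegral.integral_eq_sub_of_hasDerivAt_of_le (NNReal.coe_nonneg t) hcont
    hderiv (hcont'.intervalIntegrable_of_Icc (NNReal.coe_nonneg t))
  -- identify the integrand with `2 / realFlow`
  have hcongr : ∫ s in (0 : ℝ)..t, 2 / realFlow W x s.toNNReal = ∫ s in (0 : ℝ)..t, G' s := by
    refine intervalIntegral.integral_congr fun s hs ↦ ?_
    rw [uIcc_of_le (NNReal.coe_nonneg t)] at hs
    have hsT : (s.toNNReal : WithTop ℝ≥0) < swallowingTime W x := (hsub hs).2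
    simp only [hG']
    rw [realFlow_eq_re_sub hW hg hsT, Real.coe_toNNReal _ hs.1]
  have hG0 : G 0 = x := by simp [hG, hg.1]
  have hGt : G t = (g t).re := rfl
  rw [hcongr, hFTC, hG0, realFlow_eq_re_sub hW hg ht]
  simp only [hG]
  ring

/-! ### The frozen flow: sign-free facts and reflection -/

/-- A nonzero value of the frozen flow can only occur before the swallowing time. [folklore] -/
theorem coe_lt_swallowingTime_of_realFlowStop_ne_zero {x : ℝ} {t : ℝ≥0}
    (h : realFlowStop W x t ≠ 0) : (t : WithTop ℝ≥0) < swallowingTime W x := by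
  by_contra hle
  exact h (realFlowStop_of_le (not_lt.1 hle))

/-- **Reflection of the frozen flow**: `realFlowStop (-W) (-x) t = -realFlowStop W x t`
(the swallowing times agree, `swallowingTime_neg_ofReal`, and the real flows are opposite,
`realFlow_neg_driving`). [folklore] -/
theorem realFlowStop_neg_neg (hW : Continuous W) (x : ℝ) (t : ℝ≥0) :
    realFlowStop (fun s ↦ -W s) (-x) t = -realFlowStop W x t := by
  by_cases ht : (t : WithTop ℝ≥0) < swallowingTime W x
  · have ht' : (t : WithTop ℝ≥0) < swallowingTime (fun s ↦ -W s) ((-x : ℝ) : ℂ) := by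
      rwa [swallowingTime_neg_ofReal]
    rw [realFlowStop_of_lt ht, realFlowStop_of_lt ht', realFlow_neg_driving hW ht]
  · have ht' : ¬ (t : WithTop ℝ≥0) < swallowingTime (fun s ↦ -W s) ((-x : ℝ) : ℂ) := by
      rwa [swallowingTime_neg_ofReal]
    rw [realFlowStop_of_le (not_lt.1 ht), realFlowStop_of_le (not_lt.1 ht'), neg_zero]

/-- The frozen flow from a point to the *left* of the driving point is continuous (reflection of
`continuous_realFlowStop`). [folklore] -/
theorem continuous_realFlowStop_of_lt (hW : Continuous W) {y : ℝ} (hy : y < W 0) :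
    Continuous (realFlowStop W y) := by
  have hy' : (fun s ↦ -W s) 0 < -y := by simpa using neg_lt_neg hy
  have h := continuous_realFlowStop (W := fun s ↦ -W s) (hW.neg) hy'
  have heq : realFlowStop W y = fun t ↦ -realFlowStop (fun s ↦ -W s) (-y) t := by
    funext t; rw [realFlowStop_neg_neg hW y t, neg_neg]
  rw [heq]
  exact h.neg

/-- The frozen flow is continuous for every real point `x ≠ W₀`. [folklore] -/
theorem continuous_realFlowStop_of_ne (hW : Continuous W) {x : ℝ} (hx : x ≠ W 0) :
    Continuous (realFlowStop W x) := by
  rcases lt_or_gt_of_ne hx with h | h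
  · exact continuous_realFlowStop_of_lt hW h
  · exact continuous_realFlowStop hW h

/-- The frozen flow starts at `x - W₀` (`x ≠ W₀`). [folklore] -/
theorem realFlowStop_zero_of_ne (hW : Continuous W) {x : ℝ} (hx : x ≠ W 0) :
    realFlowStop W x 0 = x - W 0 := by
  have hx' : (x : ℂ) ≠ W 0 := fun h ↦ hx (by exact_mod_cast h)
  rw [realFlowStop_of_lt (by exact_mod_cast swallowingTime_pos_holds hW hx'), realFlow_zero hW hx]

/-- **The frozen flow in integrated form**: for `x ≠ W₀` and `t < T_x`,
`realFlowStop W x t = x - W t + ∫₀ᵗ 2 / realFlowStop W x s ds`. [cite: Lawler2005, Prop. 1.21] -/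
theorem realFlowStop_eq_sub_add_integral (hW : Continuous W) {x : ℝ} (hx : x ≠ W 0) {t : ℝ≥0}
    (ht : (t : WithTop ℝ≥0) < swallowingTime W x) :
    realFlowStop W x t = x - W t + ∫ s in (0 : ℝ)..t, 2 / realFlowStop W x s.toNNReal := by
  rw [realFlowStop_of_lt ht, realFlow_eq_sub_add_integral hW hx ht]
  congr 1
  refine intervalIntegral.integral_congr fun s hs ↦ ?_
  rw [uIcc_of_le (NNReal.coe_nonneg t)] at hs
  have hsT : (s.toNNReal : WithTop ℝ≥0) < swallowingTime W x :=
    lt_of_le_of_lt (WithTop.coe_le_coe.2 (Real.toNNReal_le_iff_le_coe.2 hs.2)) ht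
  simp only [realFlowStop_of_lt hsT]

end Loewner

/-! ### The frozen real SLE_κ flow: continuity, adaptedness, progressivity -/

section SLE

open Loewner Literature.Probability.Process Literature.Analysis.FunctionSpaces

variable {κ : ℝ≥0} {x : ℝ}

/-- Unfolding of `sleRealFlowStop`. [folklore] -/
theorem sleRealFlowStop_apply (κ : ℝ≥0) (x : ℝ) (t : ℝ≥0) (ω : ℝ≥0 → ℝ) :
    sleRealFlowStop κ x t ω = realFlowStop (sleDriving κ ω) x t := rfl

/-- The frozen real SLE_κ flow from `x ≠ 0` has continuous paths (every `ω`). [folklore] -/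
theorem continuous_sleRealFlowStop (hx : x ≠ 0) (ω : ℝ≥0 → ℝ) :
    Continuous fun t ↦ sleRealFlowStop κ x t ω :=
  continuous_realFlowStop_of_ne (continuous_sleDriving κ ω) (by rwa [sleDriving_zero])

/-- The frozen real SLE_κ flow starts at `x`. [folklore] -/
theorem sleRealFlowStop_zero_apply (hx : x ≠ 0) (ω : ℝ≥0 → ℝ) : sleRealFlowStop κ x 0 ω = x := by
  rw [sleRealFlowStop_apply, realFlowStop_zero_of_ne (continuous_sleDriving κ ω)
    (by rwa [sleDriving_zero]), sleDriving_zero, sub_zero]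

/-- The frozen real SLE_κ flow is adapted to the raw Brownian filtration
(`measurable_realFlow_sle`). [folklore] -/
theorem adapted_sleRealFlowStop (κ : ℝ≥0) (hx : x ≠ 0) :
    Adapted brownianFiltration (sleRealFlowStop κ x) := fun t ↦
  measurable_realFlow_sle κ hx t

/-- The frozen real SLE_κ flow is strongly adapted. [folklore] -/
theorem stronglyAdapted_sleRealFlowStop (κ : ℝ≥0) (hx : x ≠ 0) :
    StronglyAdapted brownianFiltration (sleRealFlowStop κ x) := fun t ↦
  (adapted_sleRealFlowStop κ hx t).stronglyMeasurable

/-- The frozen real SLE_κ flow is progressively measurable (continuous and adapted). [folklore] -/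
theorem isStronglyProgressive_sleRealFlowStop (κ : ℝ≥0) (hx : x ≠ 0) :
    IsStronglyProgressive brownianFiltration (sleRealFlowStop κ x) :=
  (stronglyAdapted_sleRealFlowStop κ hx).isStronglyProgressive_of_continuous
    fun ω ↦ continuous_sleRealFlowStop hx ω

/-! ### The stopped frozen flow is an Itô process -/

/-- **Pathwise integrated form of the stopped frozen flow.** Let `x ≠ 0`, `ρ` a random time, and
suppose the frozen flow `X = sleRealFlowStop κ x` does not vanish on `[0, ρ]`. Then for every `ω`
and `t`, with `V = X^ρ` the stopped flow,
`V_t = x + ∫₀ᵗ 𝟙_{s ≤ ρ} 2/V_s ds - √κ B_{t ∧ ρ}`.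
Lawler (2005), §6.2, eq. (6.3) / §1.10. [cite: Lawler2005, Prop. 1.21] -/
theorem stoppedProcess_sleRealFlowStop_eq (hx : x ≠ 0) {ρ : (ℝ≥0 → ℝ) → WithTop ℝ≥0}
    (hρX : ∀ ω (t : ℝ≥0), (t : WithTop ℝ≥0) ≤ ρ ω → sleRealFlowStop κ x t ω ≠ 0)
    (ω : ℝ≥0 → ℝ) (t : ℝ≥0) :
    stoppedProcess (sleRealFlowStop κ x) ρ t ω =
      x + (∫ s in (0 : ℝ)..t, trunc ρ (fun s ω ↦ 2 / stoppedProcess (sleRealFlowStop κ x) ρ s ω)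
        s.toNNReal ω) +
      -Real.sqrt κ * brownian ((min (t : WithTop ℝ≥0) (ρ ω)).untopA) ω := by
  set u : ℝ≥0 := (min (t : WithTop ℝ≥0) (ρ ω)).untopA with hu
  have huρ : (u : WithTop ℝ≥0) ≤ ρ ω := coe_untopA_min_le t (ρ ω)
  have hW := continuous_sleDriving κ ω
  have hx' : x ≠ sleDriving κ ω 0 := by rwa [sleDriving_zero]
  have hXu : sleRealFlowStop κ x u ω ≠ 0 := hρX ω u huρ
  have huT : (u : WithTop ℝ≥0) < swallowingTime (sleDriving κ ω) x :=
    coe_lt_swallowingTime_of_realFlowStop_ne_zero hXu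
  -- the time integral of the truncated drift is the integral up to `u`
  have hint : (∫ s in (0 : ℝ)..t, trunc ρ
      (fun s ω ↦ 2 / stoppedProcess (sleRealFlowStop κ x) ρ s ω) s.toNNReal ω) =
      ∫ s in (0 : ℝ)..u, 2 / realFlowStop (sleDriving κ ω) x s.toNNReal := by
    have h1 := timeIntegral_trunc (fun s ω ↦ 2 / stoppedProcess (sleRealFlowStop κ x) ρ s ω) ρ t ω
    simp only [timeIntegral] at h1
    rw [h1]
    refine intervalIntegral.integral_congr fun s hs ↦ ?_
    rw [uIcc_of_le (NNReal.coe_nonneg _)] at hs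
    have hsρ : (s.toNNReal : WithTop ℝ≥0) ≤ ρ ω :=
      (WithTop.coe_le_coe.2 (Real.toNNReal_le_iff_le_coe.2 hs.2)).trans huρ
    simp only [stoppedProcess_eq_of_le hsρ, sleRealFlowStop_apply]
  have hstop : stoppedProcess (sleRealFlowStop κ x) ρ t ω = realFlowStop (sleDriving κ ω) x u := rfl
  rw [hint, hstop, realFlowStop_eq_sub_add_integral hW hx' huT]
  simp only [sleDriving]
  ring

/-- **The stopped frozen real SLE_κ flow is an Itô process.** Let `x ≠ 0`, let `ρ` be a stopping
time of the raw Brownian filtration, and suppose the frozen real flow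
`X = sleRealFlowStop κ x` (`Xₜ = re gₜ(x) - √κ Bₜ` before `T_x`, `0` after) does not vanish on
`[0, ρ]` (e.g. `ρ` an exit time from an interval bounded away from `0`, so that `ρ < T_x`). Then
the stopped flow `V = X^ρ` is an Itô process driven by the canonical Brownian motion, with drift
`𝟙_{s ≤ ρ} 2/V_s` and diffusion coefficient `𝟙_{s ≤ ρ} (-√κ)`:
`V_t = x + ∫₀ᵗ 𝟙_{s ≤ ρ} 2/V_s ds + ∫₀ᵗ 𝟙_{s ≤ ρ}(-√κ) dB_s`. Pathwise this is the Loewner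
equation for real points in integrated form (`stoppedProcess_sleRealFlowStop_eq`); the stochastic
term is the Itô integral of the truncated constant, indistinguishable from `-√κ B^ρ`
(`IsItoIntegral.ae_eq_stoppedProcess`, Revuz–Yor IV (2.5)). This is the SDE
`dX = (2/X) dt - √κ dB` of Lawler (2005), §6.2, eq. (6.3) (there `dĝ = (a/ĝ) dt + dW`,
`a = 2/κ`, after the time change `ĝ_t = g_{t/κ}/√κ`) and §1.10, localised before the swallowing
time. [cite: Lawler2005, Prop. 1.21] -/
theorem isItoProcess_stoppedProcess_sleRealFlowStop (hx : x ≠ 0)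
    {ρ : (ℝ≥0 → ℝ) → WithTop ℝ≥0} (hρ : IsStoppingTime brownianFiltration ρ)
    (hρX : ∀ ω (t : ℝ≥0), (t : WithTop ℝ≥0) ≤ ρ ω → sleRealFlowStop κ x t ω ≠ 0) :
    IsItoProcess (stoppedProcess (sleRealFlowStop κ x) ρ)
      (trunc ρ fun s ω ↦ 2 / stoppedProcess (sleRealFlowStop κ x) ρ s ω)
      (trunc ρ fun _ _ ↦ -Real.sqrt κ) brownian brownianFiltration preWienerMeasure := by
  haveI := isProbabilityMeasure_preWienerMeasure'
  set X := sleRealFlowStop κ x with hXdef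
  set V := stoppedProcess X ρ with hVdef
  have hρ' : ∀ t : ℝ≥0, MeasurableSet[brownianFiltration t] {ω | ρ ω < t} :=
    fun t ↦ hρ.measurableSet_lt t
  -- the paths of `V` are continuous and never vanish
  have hVc : ∀ ω, Continuous fun s ↦ V s ω := fun ω ↦
    continuous_stoppedProcess_apply (continuous_sleRealFlowStop hx ω) ρ
  have hVne : ∀ ω s, V s ω ≠ 0 := by
    intro ω s
    simp only [hVdef, stoppedProcess]
    exact hρX ω _ (coe_untopA_min_le s (ρ ω))
  refine ⟨ae_of_all _ fun ω t ↦ ?_, ?_⟩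
  · -- the drift is locally integrable: `2/V` is continuous in time
    refine integrableOn_trunc ?_
    have hc : Continuous fun r : ℝ ↦ 2 / V r.toNNReal ω :=
      continuous_const.div ((hVc ω).comp continuous_real_toNNReal) fun r ↦ hVne ω _
    exact hc.continuousOn.integrableOn_compact isCompact_Icc
  · -- the Itô integral of the truncated constant, a square-integrable martingale
    have hσ : IsStronglyProgressive brownianFiltration
        (trunc ρ fun (_ : ℝ≥0) (_ : ℝ≥0 → ℝ) ↦ -Real.sqrt κ) :=
      isStronglyProgressive_trunc (isStronglyProgressive_const _ _) hρ'
    have hfin : ∀ t : ℝ≥0, ∫⁻ ω, (∫⁻ s in Set.Icc (0 : ℝ) t, ENNReal.ofReal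
        ((trunc ρ (fun (_ : ℝ≥0) (_ : ℝ≥0 → ℝ) ↦ -Real.sqrt κ)) s.toNNReal ω ^ 2))
        ∂preWienerMeasure ≠ ∞ := by
      intro t
      have hle : ∀ ω : ℝ≥0 → ℝ, (∫⁻ s in Set.Icc (0 : ℝ) t, ENNReal.ofReal
          ((trunc ρ (fun (_ : ℝ≥0) (_ : ℝ≥0 → ℝ) ↦ -Real.sqrt κ)) s.toNNReal ω ^ 2)) ≤
          ENNReal.ofReal κ * volume (Set.Icc (0 : ℝ) t) := by
        intro ω
        rw [← setLIntegral_const]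
        refine lintegral_mono fun s ↦ ENNReal.ofReal_le_ofReal ?_
        rw [trunc_apply]
        split_ifs
        · rw [neg_sq, Real.sq_sqrt κ.coe_nonneg]
        · simp
      refine ne_top_of_le_ne_top ?_ (lintegral_mono hle)
      rw [lintegral_const, measure_univ, mul_one, Real.volume_Icc, sub_zero]
      exact ENNReal.mul_ne_top ENNReal.ofReal_ne_top ENNReal.ofReal_ne_top
    obtain ⟨J, hJ, -, -⟩ := exists_isItoIntegral_of_sq_integrable hσ hfin
    have hJeq := IsItoIntegral.ae_eq_stoppedProcess martingale_brownian_holds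
      martingale_brownian_sq_sub_holds memLp_two_brownian continuous_brownian
      (H := fun (_ : ℝ≥0) (_ : ℝ≥0 → ℝ) ↦ -Real.sqrt κ) measurable_const hρ'
      (isItoIntegral_const_brownian (-Real.sqrt κ)) hJ
    refine ⟨J, hJ, ?_⟩
    filter_upwards [hJeq] with ω hω t
    have h0 : V 0 ω = x := by
      simp only [hVdef]
      rw [stoppedProcess_eq_of_le (coe_zero_le_withTop _)]
      exact sleRealFlowStop_zero_apply hx ω
    rw [hω t, h0]
    exact stoppedProcess_sleRealFlowStop_eq hx hρX ω t

end SLE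

end Literature.Probability.RandomPlanarGeometry
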